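import Mathlib.Data.Real.Basic
import Mathlib.Tactic.Linarith
import Mathlib.Tactic.Positivity
import Mathlib.Tactic.Ring
import HarnessLib

/-!
# `NoHeavyLowerTail` (stmt-CriticalPhenomena-4575) — CONJECTURE F under apex piece-union: the easy aligned leaf (two c-leaning pieces, target `F_c`)

Support file (prover prim-ineq-gen-8 gen 35; `--supports stmt-CriticalPhenomena-4575`; memos
run/shared/lean/prim/prim-ineq-gen-8/FINDING-gen35-CONJF-UNION.md §5 and FINDING-gen34-CONJF.md §0(5)).
Pure real algebra: no definitions, no named facts, no sorries.

SETTING (normalised gadget coordinates, as in `…APLConjFUnion.lean`): an instance `(a; b, c)` with cells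
`u0 = P(a|b|c), uab = P(ab|c), uac = P(ac|b), ubc = P(a|bc), u3 = P(abc)` of total mass `1` is
`u = (D, x, y, r)` with `D = u0+uab+uac`, `x = uab/D`, `y = uac/D`, `r = uab+uac+u3`; `F_c(u) : 2r ≤ 3(x+y) − D(x−y)`,
`F_b(u) : 2r ≤ 3(x+y) + D(x−y)`, APL(2/3) `: 2r ≤ 3(x+y)` (the mean of `F_b`, `F_c`).  For two instances meeting only in
`{a,b,c}` the apex piece-union `w` has `F_c(w) = D·D'·Φ` with
`Φ = (1 − (x y' + y x'))(1 + 2(1−r)(1−r') − D D' M) − 3(1−x−y)(1−x'−y')`, `M = (x−y)(1−(x'+y')/2) − (y'−x')(1−(x+y)/2)`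
(gen 34 memo §0(2)).

THEOREM (`conjF_c_union_cc_norm`).  If both pieces are c-leaning (`x ≤ y`, `x' ≤ y'`), `x+y ≤ 2/3` (`2u0 ≥ e_u`; the light case
`e_u ≥ 2u0` is gen 34's LEMMA N), both satisfy APL(2/3) and `r' ≤ 1`, then `Φ ≥ 0`: in the master identity
`Φ = (3/2)((QQ'+hh')s − hh') + κσ'(2−3Q)/2 + κσ(1−r') − κDD'E` (`h = x−y ≤ 0 ≤ h' = y'−x'`, `σ = 3Q−2r ≥ 0`, `σ' ≥ 0`,
`κ = 1 − (xy'+yx') ≥ 0`, `E = h(1−Q'/2) − h'(1−Q/2) ≤ 0`, `s = Q+Q'−(3/2)QQ' ≥ 0`) every term is nonnegative.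
So `F_c` of the union of two c-leaning pieces — and, by the `b ↔ c` mirror (`conjF_b_union_bb_norm`), `F_b` of the union of two
b-leaning pieces — needs nothing beyond APL(2/3) of the pieces; the hard aligned leaf is `F_c` for two b-leaning pieces
(`…APLConjFAligned.lean`). [folklore algebra]
-/

namespace Summit.CriticalPhenomena.PercolationContinuityZ3.Theorems

namespace APL

set_option maxHeartbeats 800000 in
/-- **LEMMA U″, easy aligned leaf: two c-leaning pieces, target `F_c`.**  Hypotheses: `0 ≤ x ≤ y`, `x+y ≤ 2/3`, `0 ≤ D`,
APL(2/3) `2r ≤ 3(x+y)` for `u`; `0 ≤ x' ≤ y'`, `x'+y' ≤ 1`, `0 ≤ D'`, `2r' ≤ 3(x'+y')`, `r' ≤ 1` for `v`.  Conclusion: the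
`F_c`-slack `Φ` of the apex piece-union is nonnegative. [folklore] -/
theorem conjF_c_union_cc_norm (D x y r D' x' y' r' : ℝ)
    (hx : 0 ≤ x) (hxy : x ≤ y) (hQ : x + y ≤ 2/3) (hD : 0 ≤ D) (hσ : 2*r ≤ 3*(x+y))
    (hx' : 0 ≤ x') (hxy' : x' ≤ y') (hQ' : x' + y' ≤ 1) (hD' : 0 ≤ D') (hσ' : 2*r' ≤ 3*(x'+y')) (ha' : r' ≤ 1) :
    0 ≤ (1 - (x*y' + y*x')) * (1 + 2*(1-r)*(1-r')
          - D*D'*((x-y)*(1-(x'+y')/2) - (y'-x')*(1-(x+y)/2)))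
        - 3*(1-(x+y))*(1-(x'+y')) := by
  have key : (1 - (x*y' + y*x')) * (1 + 2*(1-r)*(1-r')
          - D*D'*((x-y)*(1-(x'+y')/2) - (y'-x')*(1-(x+y)/2)))
        - 3*(1-(x+y))*(1-(x'+y'))
      = 3/2*((((x+y)*(x'+y') + (x-y)*(y'-x'))*((x+y)+(x'+y')-3/2*(x+y)*(x'+y'))) - (x-y)*(y'-x'))
        + (1 - (x*y' + y*x'))*(3*(x'+y')-2*r')*(2-3*(x+y))/2
        + (1 - (x*y' + y*x'))*(3*(x+y)-2*r)*(1-r')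
        + (1 - (x*y' + y*x'))*D*D'*(-((x-y)*(1-(x'+y')/2) - (y'-x')*(1-(x+y)/2))) := by
    ring
  rw [key]
  have hy : 0 ≤ y := le_trans hx hxy
  have hy' : 0 ≤ y' := le_trans hx' hxy'
  have hκ : 0 ≤ 1 - (x*y' + y*x') := by nlinarith [mul_nonneg hx hx', mul_nonneg hy hy']
  have hs : 0 ≤ (x+y)+(x'+y')-3/2*(x+y)*(x'+y') := by nlinarith [mul_nonneg (add_nonneg hx hy) (add_nonneg hx' hy')]
  have hC : 0 ≤ (x+y)*(x'+y') + (x-y)*(y'-x') := by nlinarith [mul_nonneg hx hx', mul_nonneg hy hy']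
  have hhh : 0 ≤ -((x-y)*(y'-x')) := by nlinarith [mul_nonneg (sub_nonneg.2 hxy) (sub_nonneg.2 hxy')]
  have hb : 0 ≤ 3/2*((((x+y)*(x'+y') + (x-y)*(y'-x'))*((x+y)+(x'+y')-3/2*(x+y)*(x'+y'))) - (x-y)*(y'-x')) := by
    have := mul_nonneg hC hs; linarith
  have h1 : 0 ≤ (1 - (x*y' + y*x'))*(3*(x'+y')-2*r')*(2-3*(x+y))/2 := by
    have := mul_nonneg (mul_nonneg hκ (by linarith : 0 ≤ 3*(x'+y')-2*r')) (by linarith : 0 ≤ 2-3*(x+y)); linarith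
  have h2 : 0 ≤ (1 - (x*y' + y*x'))*(3*(x+y)-2*r)*(1-r') :=
    mul_nonneg (mul_nonneg hκ (by linarith)) (by linarith)
  have hE : 0 ≤ -((x-y)*(1-(x'+y')/2) - (y'-x')*(1-(x+y)/2)) := by
    have e1 : 0 ≤ (y-x)*(1-(x'+y')/2) := mul_nonneg (by linarith) (by linarith)
    have e2 : 0 ≤ (y'-x')*(1-(x+y)/2) := mul_nonneg (by linarith) (by linarith)
    nlinarith
  have h3 : 0 ≤ (1 - (x*y' + y*x'))*D*D'*(-((x-y)*(1-(x'+y')/2) - (y'-x')*(1-(x+y)/2))) :=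
    mul_nonneg (mul_nonneg (mul_nonneg hκ hD) hD') hE
  linarith

/-- Mirror: **two b-leaning pieces, target `F_b`** (the `F_b`-slack of the union is `D·D'·Φ_b` with `Φ_b` = `Φ` after `x ↔ y`,
`x' ↔ y'`).  Hypotheses: `0 ≤ y ≤ x`, `x+y ≤ 2/3`, `0 ≤ D`, `2r ≤ 3(x+y)`; `0 ≤ y' ≤ x'`, `x'+y' ≤ 1`, `0 ≤ D'`, `2r' ≤ 3(x'+y')`,
`r' ≤ 1`. [folklore] -/
theorem conjF_b_union_bb_norm (D x y r D' x' y' r' : ℝ)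
    (hy : 0 ≤ y) (hyx : y ≤ x) (hQ : x + y ≤ 2/3) (hD : 0 ≤ D) (hσ : 2*r ≤ 3*(x+y))
    (hy' : 0 ≤ y') (hyx' : y' ≤ x') (hQ' : x' + y' ≤ 1) (hD' : 0 ≤ D') (hσ' : 2*r' ≤ 3*(x'+y')) (ha' : r' ≤ 1) :
    0 ≤ (1 - (y*x' + x*y')) * (1 + 2*(1-r)*(1-r')
          - D*D'*((y-x)*(1-(y'+x')/2) - (x'-y')*(1-(y+x)/2)))
        - 3*(1-(y+x))*(1-(y'+x')) :=
  conjF_c_union_cc_norm D y x r D' y' x' r' hy hyx (by linarith) hD (by linarith) hy' hyx' (by linarith) hD'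
    (by linarith) ha'

end APL

end Summit.CriticalPhenomena.PercolationContinuityZ3.Theorems
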